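import Summits.CriticalPhenomena.PercolationContinuityZ3.Theorems.PercNearOneGluingNoHeavyLowerTailKnQuestion8TstarXFrameless
import HarnessLib

/-!
# KN Question 8 at `|A| = 3`: the XD reduction of the atom (T*) — (T*) ⟸ XD ∧ (α) ∧ PAC, and XD for the `x`-class at `Y = ∅`

Support file (`--supports stmt-CriticalPhenomena-4575`, closed crux; independent mathematics on Kozma–Nitzan's Question 8 at
`|A| = 3`, arXiv:2401.12397 §5.5 p. 36), prover `prim-ineq-gen-7` (gen 15).  No definitions, no named facts, no sorries; standard axioms.
Memo `prim-ineq-gen-7/FINDING-XD-g15.md` §1–§3.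

Setting (memo FINDING-TSTAR-g12 §0): owner `x`, observers `o, v`; cells of the connection pattern `O = {x↔o}`, `E = {x↮o}∩{o↔v}`,
`PV = {x↮o}∩{o↮v}∩{x↔v}`, `PM = {x↮o}∩{o↮v}∩{x↮v}`; masses `a, e, π_V, π_M` (`a+e+π_V+π_M = 1`) and integrals `I_O, I_E, I_PV, I_PM`
of a test function `g`, `I = I_O+I_E+I_PV+I_PM`.  The atom (T*) in its cubic form (FINDING-TSTAR2-g13 (★★)) is
`S := π_M·(π·I_O − (a+e)·I_PV) − (aπ_M − eπ_V)·I_PM ≥ 0` (`π = π_V+π_M`).  Gen 15 isolates the covariance inequality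
      **XD:  `π_M·Cov(g, 1_O) ≥ e·Cov(g, 1_PV)`**,  i.e. `D' := π_M(I_O − a·I) − e(I_PV − π_V·I) ≥ 0`,
with the exact identity  `S = π·D' + (aπ_M − eπ_V)·A`,  `A := π(I_O+I_E) − (a+e)(I_PV+I_PM) = Cov(g, 1_{O ⊔ E})`.
* `PocketCert.tstar_of_xd_abstract` — the scalar skeleton: XD ∧ (α) (`A ≥ 0`) ∧ PAC (`aπ_M ≥ eπ_V`) ⟹ (T*), pure real arithmetic.
  With a frame `{x,o}↮Y` (any `Y`), (α) is van den Berg–Häggström–Kahn Thm 2.1 and PAC is the tree's `PcovJ1.t3_measure`, so the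
  covariance half (T1) of KN Q8@3 follows from XD for the `x`-class under the frame measure (census: memo §2; 0 violations).
* `PocketCert.xd_xclass_frameless` — **XD for every increasing nonnegative `F(C x)` at `Y = ∅`**, via the second identity
  `D' = (e+π_M)·A + (e·I_PM − π_M·I_E)`: Harris for the increasing event `{x↔o} ∪ {o↔v}` (`AGloc.setIntegral_clusterFun_ge`) and K2b
  (`PocketCert.xclass_k2b_frameless`, vdBHK Thm 2.1 with `S = {x}`, `T = {o,v}`).  XD is strictly stronger than (T*) (by `(aπ_M−eπ_V)·A/π`)
  and is FALSE for the union/pair classes (memo §2); it is specific to the `x`-class.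
[cite: VandenbergHaggstromKahn2005, Thm. 1.4 (p. 7), Thm. 2.1 (p. 9)] [cite: KozmaNitzan2024, Question 8 (§5.5 p. 36)]
-/

namespace Summit.CriticalPhenomena.PercolationContinuityZ3.Theorems

open MeasureTheory Set Literature.Probability.LatticeModels Literature.Probability.Percolation
open scoped Classical
open KNPreFKG

noncomputable section

namespace PocketCert

variable {V : Type*} [Fintype V]

/-- **(T*) ⟸ XD ∧ (α) ∧ PAC (scalar skeleton).**  Reals `a e pV pM` (cell masses, summing to `1`, `pV + pM ≥ 0`) and cell integrals
`IO IE IPV IPM` of a test function.  If PAC `e·pV ≤ a·pM`, (α) `(a+e)(IPV+IPM) ≤ (pV+pM)(IO+IE)` and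
XD `e·(IPV − pV·I) ≤ pM·(IO − a·I)` (`I = IO+IE+IPV+IPM`), then the cubic (T*)-margin is nonnegative:
`(a·pM − e·pV)·IPM ≤ pM·((pV+pM)·IO − (a+e)·IPV)`.  Identity: `S = (pV+pM)·D' + (a·pM − e·pV)·A`. -/
theorem tstar_of_xd_abstract (a e pV pM IO IE IPV IPM : ℝ) (hsum : a + e + pV + pM = 1) (hπ : 0 ≤ pV + pM)
    (hPAC : e * pV ≤ a * pM) (hA : (a + e) * (IPV + IPM) ≤ (pV + pM) * (IO + IE))
    (hXD : e * (IPV - pV * (IO + IE + IPV + IPM)) ≤ pM * (IO - a * (IO + IE + IPV + IPM))) :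
    (a * pM - e * pV) * IPM ≤ pM * ((pV + pM) * IO - (a + e) * IPV) := by
  have hpM : pM = 1 - a - e - pV := by linarith
  subst hpM
  nlinarith [mul_le_mul_of_nonneg_left hXD hπ, mul_le_mul_of_nonneg_left hA (sub_nonneg.mpr hPAC)]

/-- **XD for the `x`-class without a frame.**  `F` monotone nonnegative on vertex sets, `f = F(C x)`; cells `O = {x↔o}`,
`E = {x↮o}∩{o↔v}`, `PV = {x↮o}∩{o↮v}∩{x↔v}`, `PM = {x↮o}∩{o↮v}∩{x↮v}`.  Then
`μ(E)·( ∫_{PV} f − μ(PV)·∫ f ) ≤ μ(PM)·( ∫_O f − μ(O)·∫ f )`, i.e. `μ(PM)·Cov(f,1_O) ≥ μ(E)·Cov(f,1_{PV})`: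
Harris on `{x↔o} ∪ {o↔v}` (`μ(O⊔E)·∫ f ≤ ∫_{O⊔E} f`) plus K2b (`μ(PM)∫_E f ≤ μ(E)∫_{PM} f`) via
`D' = (μ(E)+μ(PM))·[∫_{O⊔E} f − μ(O⊔E)∫ f] + [μ(E)∫_{PM} f − μ(PM)∫_E f]`.
[cite: VandenbergHaggstromKahn2005, Thm. 1.4 (p. 7), Thm. 2.1 (p. 9)] [cite: KozmaNitzan2024, Question 8 (§5.5 p. 36)] -/
theorem xd_xclass_frameless (w : Sym2 V → unitInterval) (x o v : V) (F : Set V → ℝ)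
    (hF : ∀ S T : Set V, S ⊆ T → F S ≤ F T) (hF0 : ∀ S, 0 ≤ F S) :
    (prodBernoulli w).real ({ω : BondConfig V | ¬ (openGraph ω).Reachable x o} ∩ openConn o v) *
        (∫ ω in {ω : BondConfig V | ¬ (openGraph ω).Reachable x o} ∩ {ω | ¬ (openGraph ω).Reachable o v} ∩
            openConn x v, F (openCluster ω x) ∂(prodBernoulli w) -
          (prodBernoulli w).real ({ω : BondConfig V | ¬ (openGraph ω).Reachable x o} ∩
              {ω | ¬ (openGraph ω).Reachable o v} ∩ openConn x v) *
            ∫ ω, F (openCluster ω x) ∂(prodBernoulli w)) ≤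
    (prodBernoulli w).real ({ω : BondConfig V | ¬ (openGraph ω).Reachable x o} ∩
        {ω | ¬ (openGraph ω).Reachable o v} ∩ {ω | ¬ (openGraph ω).Reachable x v}) *
      (∫ ω in openConn x o, F (openCluster ω x) ∂(prodBernoulli w) -
        (prodBernoulli w).real (openConn x o) * ∫ ω, F (openCluster ω x) ∂(prodBernoulli w)) := by
  classical
  set μ := prodBernoulli w with hμ
  set f : BondConfig V → ℝ := fun ω => F (openCluster ω x) with hf
  have hmeas : ∀ S' : Set (BondConfig V), MeasurableSet S' := fun _ => MeasurableSet.of_discrete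
  have hint : ∀ (g : BondConfig V → ℝ) (S' : Set (BondConfig V)), IntegrableOn g S' μ :=
    fun g S' => (Integrable.of_finite).integrableOn
  have hn := fun (S' : Set (BondConfig V)) => (measureReal_nonneg : 0 ≤ μ.real S')
  have hfi := fun (S' : Set (BondConfig V)) =>
    (setIntegral_nonneg (hmeas S') fun ω _ => hF0 (openCluster ω x) : 0 ≤ ∫ ω in S', f ω ∂μ)
  -- the cells
  set O : Set (BondConfig V) := openConn x o with hO
  set Ev : Set (BondConfig V) := {ω : BondConfig V | ¬ (openGraph ω).Reachable x o} ∩ openConn o v with hEv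
  set PV : Set (BondConfig V) := {ω : BondConfig V | ¬ (openGraph ω).Reachable x o} ∩
    {ω | ¬ (openGraph ω).Reachable o v} ∩ openConn x v with hPV
  set PM : Set (BondConfig V) := {ω : BondConfig V | ¬ (openGraph ω).Reachable x o} ∩
    {ω | ¬ (openGraph ω).Reachable o v} ∩ {ω | ¬ (openGraph ω).Reachable x v} with hPM
  set P : Set (BondConfig V) := {ω : BondConfig V | ¬ (openGraph ω).Reachable x o} ∩
    {ω | ¬ (openGraph ω).Reachable o v} with hP
  set U2 : Set (BondConfig V) := openConn x o ∪ openConn o v with hU2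
  -- set algebra (as in `tstar_xclass_frameless`)
  have hU2eq : U2 = O ∪ Ev := by
    ext ω
    simp only [hU2, hO, hEv, mem_union, mem_inter_iff, mem_setOf_eq, openConn]
    constructor
    · rintro (hxo | hov)
      · exact Or.inl hxo
      · by_cases hxo : (openGraph ω).Reachable x o
        · exact Or.inl hxo
        · exact Or.inr ⟨hxo, hov⟩
    · rintro (hxo | ⟨-, hov⟩)
      · exact Or.inl hxo
      · exact Or.inr hov
  have hdOE : Disjoint O Ev := by
    rw [Set.disjoint_left]
    rintro ω hxo ⟨hxo', -⟩
    exact hxo' hxo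
  have hPeq : P = PV ∪ PM := by
    ext ω
    simp only [hP, hPV, hPM, mem_union, mem_inter_iff, mem_setOf_eq, openConn]
    constructor
    · rintro ⟨hxo, hov⟩
      by_cases hxv : (openGraph ω).Reachable x v
      · exact Or.inl ⟨⟨hxo, hov⟩, hxv⟩
      · exact Or.inr ⟨⟨hxo, hov⟩, hxv⟩
    · rintro (⟨⟨hxo, hov⟩, -⟩ | ⟨⟨hxo, hov⟩, -⟩) <;> exact ⟨hxo, hov⟩
  have hdVM : Disjoint PV PM := by
    rw [Set.disjoint_left]
    rintro ω ⟨-, hxv⟩ ⟨-, hxv'⟩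
    exact hxv' hxv
  have hUniv : (univ : Set (BondConfig V)) = U2 ∪ P := by
    ext ω
    simp only [hU2, hP, mem_univ, mem_union, mem_inter_iff, mem_setOf_eq, openConn, true_iff]
    by_cases hxo : (openGraph ω).Reachable x o
    · exact Or.inl (Or.inl hxo)
    · by_cases hov : (openGraph ω).Reachable o v
      · exact Or.inl (Or.inr hov)
      · exact Or.inr ⟨hxo, hov⟩
  have hdUP : Disjoint U2 P := by
    rw [Set.disjoint_left]
    rintro ω hU ⟨hxo, hov⟩
    simp only [hU2, mem_union, openConn, mem_setOf_eq] at hU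
    rcases hU with h | h
    · exact hxo h
    · exact hov h
  have eU2 : μ.real U2 = μ.real O + μ.real Ev := by rw [hU2eq, measureReal_union hdOE (hmeas _)]
  have iU2 : ∫ ω in U2, f ω ∂μ = ∫ ω in O, f ω ∂μ + ∫ ω in Ev, f ω ∂μ := by
    rw [hU2eq, setIntegral_union hdOE (hmeas _) (hint _ _) (hint _ _)]
  have eP : μ.real P = μ.real PV + μ.real PM := by rw [hPeq, measureReal_union hdVM (hmeas _)]
  have iP : ∫ ω in P, f ω ∂μ = ∫ ω in PV, f ω ∂μ + ∫ ω in PM, f ω ∂μ := by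
    rw [hPeq, setIntegral_union hdVM (hmeas _) (hint _ _) (hint _ _)]
  have eTot : μ.real U2 + μ.real P = 1 := by
    rw [← measureReal_union hdUP (hmeas _), ← hUniv, probReal_univ]
  have iTot : ∫ ω, f ω ∂μ = ∫ ω in U2, f ω ∂μ + ∫ ω in P, f ω ∂μ := by
    rw [← setIntegral_univ, hUniv, setIntegral_union hdUP (hmeas _) (hint _ _) (hint _ _)]
  -- (1) Harris on `U2 = {x↔o} ∪ {o↔v}`
  have hHarris : μ.real U2 * ∫ ω, f ω ∂μ ≤ ∫ ω in U2, f ω ∂μ :=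
    AGloc.setIntegral_clusterFun_ge w x F hF hF0 U2 ((isUpperSet_openConn x o).union (isUpperSet_openConn o v))
  -- (2) K2b
  have hK2b := xclass_k2b_frameless w x o v F hF
  change μ.real PM * ∫ ω in Ev, f ω ∂μ ≤ μ.real Ev * ∫ ω in PM, f ω ∂μ at hK2b
  -- (3) assemble through `D' = (e+pM)·[I_{U2} − μ(U2)·I] + [e·IPM − pM·IE]`
  rw [iTot, iU2, iP, eU2] at hHarris
  have h1 : 0 ≤ (∫ ω in O, f ω ∂μ + ∫ ω in Ev, f ω ∂μ) -
      (μ.real O + μ.real Ev) * (∫ ω in O, f ω ∂μ + ∫ ω in Ev, f ω ∂μ + (∫ ω in PV, f ω ∂μ + ∫ ω in PM, f ω ∂μ)) := by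
    linarith [hHarris]
  have h2 : 0 ≤ μ.real Ev * ∫ ω in PM, f ω ∂μ - μ.real PM * ∫ ω in Ev, f ω ∂μ := by linarith [hK2b]
  have h3 := mul_nonneg (add_nonneg (hn Ev) (hn PM)) h1
  have ha : μ.real O = 1 - μ.real Ev - μ.real PV - μ.real PM := by linarith [eTot, eU2, eP]
  change μ.real Ev * (∫ ω in PV, f ω ∂μ - μ.real PV * ∫ ω, f ω ∂μ) ≤
    μ.real PM * (∫ ω in O, f ω ∂μ - μ.real O * ∫ ω, f ω ∂μ)
  rw [iTot, iU2, iP, ha]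
  rw [ha] at h3
  nlinarith [h3, h2, hn PM, hn PV, hn Ev, hfi O, hfi Ev, hfi PV, hfi PM]

end PocketCert

end

end Summit.CriticalPhenomena.PercolationContinuityZ3.Theorems
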